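import Mathlib
import Summits.ValiantsHypothesis.ValiantsHypothesis.Theses.TwistedDetRank
import Summits.ValiantsHypothesis.ValiantsHypothesis.Theorems.TwistedDetRankTdrPerNotQPStubConeRestriction
import Summits.ValiantsHypothesis.ValiantsHypothesis.Theorems.TwistedDetRankTdrPerNotQPStubConePowerRankThree
import Summits.ValiantsHypothesis.ValiantsHypothesis.Theorems.TwistedDetRankTdrPerNotQPStubExpBeatsQP

/-!
# Route TwistedDetRank — crux `TdrPerNotQP` (stmt-ValiantsHypothesis-6284, X1 of the thesis)

**Theorem.** The twisted-determinantal rank of the permanent is not quasi-polynomially bounded: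
there is no `c` such that for every `n`, `per_n` is a sum of at most `2^((log₂ n + c)^c)`
Hadamard-twisted determinants `det (X ∘ E_t)`, `E_t ∈ ℂ^{n×n}`.  In fact the proof gives the
EXPONENTIAL bound `tdr(per_{3m}) ≥ (3/2)^m`, i.e. `tdr(per_n) ≥ (3/2)^{⌊n/3⌋}`.

**Proof** (line `registered` of the crux, lead prover; three landed stubs composed here).
* `stub_coneRestriction` (Young-subgroup restriction in coefficient space): a representation
  `per_{m·k} = ∑_{t<r} det (X ∘ E_t)` is the coefficient identity `sgn = ∑_t Ê_t` on `𝔖_{mk}`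
  (`Ê(σ) = ∏_i E (σ i) i`); restricted to block permutations it is a length-`r` decomposition
  `sgn_k^{⊗m} = ∑_t û_{t,1} ⊗ ⋯ ⊗ û_{t,m}` into products of points of the Birkhoff cone
  `Y_k = {û} ⊂ ℂ^{𝔖_k}`.
* `stub_conePowerRankThree` (the heart, `k = 3`): the cone `Y_3` lies on the cubic
  `z_{id} z_{(012)} z_{(021)} = z_{(01)} z_{(02)} z_{(12)}`, which has the `3 × 3` linear
  determinantal representation `L(z) = [[z_id, -z_(01), 0], [0, z_(012), z_(02)], [z_(12), 0, z_(021)]]`;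
  so `rank L(û) ≤ 2` on the cone while `det L(sgn_3) = 2`.  Applying the Kronecker power `L^{⊗m}`
  to the decomposition and using multiplicativity and subadditivity of rank gives `3^m ≤ r · 2^m`.
* `stub_expBeatsQP`: for every `c` some `m` has `2^((log₂ m + c)^c) · 2^m < 3^m`.
Composition: a quasi-polynomial bound `c` at `n = 3m` gives `r ≤ 2^((log₂(3m) + c)^c) ≤
2^((log₂ m + c')^{c'})` with `c' = c + 4` (`log₂(3m) ≤ log₂ m + 3`), contradicting the two
displayed inequalities at the `m` supplied for `c'`.

The card's "flattenings are blind" caveat concerned Segre/Laplace flattenings of the product vector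
`sgn^{⊗m}`; the flattening `L` of each factor `ℂ^6 → ℂ^{3×3}` sees the cubic equation of `Y_3`.
-/

-- the mandated summit-side namespace repeats a component by design (single-problem summit)
set_option linter.dupNamespace false

namespace Summit.ValiantsHypothesis.ValiantsHypothesis.Theorems

open TwistedDetRankTdrPerNotQP

/-- `log₂ (m·k) ≤ log₂ m + k` (crude, all naturals). -/
theorem tdrPerNotQP_log_two_mul_le (m k : ℕ) : Nat.log 2 (m * k) ≤ Nat.log 2 m + k := by
  rcases Nat.eq_zero_or_pos (m * k) with h0 | h0
  · simp [h0]
  · have hlt : m * k < 2 ^ (Nat.log 2 m + 1 + k) := by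
      calc m * k < 2 ^ (Nat.log 2 m + 1) * 2 ^ k :=
            Nat.mul_lt_mul'' (Nat.lt_pow_succ_log_self one_lt_two m) Nat.lt_two_pow_self
        _ = 2 ^ (Nat.log 2 m + 1 + k) := by rw [← pow_add]
    have := (Nat.log_lt_iff_lt_pow one_lt_two h0.ne').2 hlt
    omega

/-- Quasi-polynomial bookkeeping along `n = m·k`: a bound `2^((log₂(mk) + c)^c)` is a bound
`2^((log₂ m + c')^{c'})` with `c' = c + k + 1`. -/
theorem tdrPerNotQP_qp_transfer (m k c : ℕ) :
    2 ^ ((Nat.log 2 (m * k) + c) ^ c) ≤ 2 ^ ((Nat.log 2 m + (c + k + 1)) ^ (c + k + 1)) := by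
  have hlog := tdrPerNotQP_log_two_mul_le m k
  calc 2 ^ ((Nat.log 2 (m * k) + c) ^ c)
      ≤ 2 ^ ((Nat.log 2 m + (c + k + 1)) ^ c) :=
        Nat.pow_le_pow_right two_pos (Nat.pow_le_pow_left (by omega) c)
    _ ≤ 2 ^ ((Nat.log 2 m + (c + k + 1)) ^ (c + k + 1)) :=
        Nat.pow_le_pow_right two_pos (Nat.pow_le_pow_right (by omega) (by omega))

/-- **Exponential lower bound for the twisted-determinantal rank of the permanent** (the
quantitative content of the crux): every representation of `per_{3m}` as a sum of `r`
Hadamard-twisted determinants has `3^m ≤ r · 2^m`, i.e. `tdr(per_{3m}) ≥ (3/2)^m`. -/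
theorem tdrPerNotQP_exp_lower_bound (m r : ℕ) (E : Fin r → Matrix (Fin (m * 3)) (Fin (m * 3)) ℂ)
    (hE : Literature.Computability.AlgebraicComplexity.perPoly (Fin (m * 3)) ℂ =
      ∑ t, (Matrix.of fun i j => MvPolynomial.C (E t i j) * MvPolynomial.X (i, j)).det) :
    3 ^ m ≤ r * 2 ^ m := by
  obtain ⟨u, hu⟩ := stub_coneRestriction 3 m r E hE
  exact stub_conePowerRankThree m r u hu

/-- **Item `stmt-ValiantsHypothesis-6284`** (crux `TdrPerNotQP`, X1 of route TwistedDetRank):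
the twisted-determinantal rank of the permanent is not quasi-polynomially bounded. -/
theorem tdrPerNotQP_proof :
    Summit.ValiantsHypothesis.ValiantsHypothesis.Theses.TwistedDetRank.TdrPerNotQP := by
  unfold Summit.ValiantsHypothesis.ValiantsHypothesis.Theses.TwistedDetRank.TdrPerNotQP
  rintro ⟨c, hc⟩
  obtain ⟨m, hm⟩ := stub_expBeatsQP (c + 3 + 1)
  obtain ⟨r, hr, E, hE⟩ := hc (m * 3)
  have h1 : 3 ^ m ≤ r * 2 ^ m := tdrPerNotQP_exp_lower_bound m r E hE
  have h2 : r * 2 ^ m ≤ 2 ^ ((Nat.log 2 m + (c + 3 + 1)) ^ (c + 3 + 1)) * 2 ^ m :=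
    Nat.mul_le_mul_right _ (hr.trans (tdrPerNotQP_qp_transfer m 3 c))
  omega

end Summit.ValiantsHypothesis.ValiantsHypothesis.Theorems
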